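import Mathlib

/-!
# Chain calculus for crux `ElementaryWordLength.WordPerSuperQuartic`, line `Sketch`:
# the `x_i²` sum rule

A *chain* is a product `Π_t (1 + x_{v_t} • N_t)` of `3 × 3` matrices over `MvPolynomial σ ℂ` with
constant `N_t`, one factor per letter `(v_t, N_t)` of a list `L`.  Expanding the product, the
coefficient matrix of a monomial `x^μ` is `Σ_{T : v(T) = μ} N_T`, the sum of the ordered products
over the increasing index sets `T` reading exactly `x^μ`.  For `μ = 2 e_i` these index sets are the
pairs `t < t'` with `v_t = v_{t'} = i`, so the `x_i²`-coefficient matrix of the chain is the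
time-ordered second moment `Σ_{t < t', v_t = v_{t'} = i} N_t N_{t'}`, written below as
`Σ_t [v_t = i] • N_t * (Σ_{t' > t} [v_{t'} = i] • N_{t'})` with `t : Fin L.length` and the inner
sum over `L.drop (t + 1)`.

* `ro_coeff_sq` — this entrywise identity, by induction on `L`: peeling off the first factor,
  `[x_i²](x_v · p) = [v = i] · [x_i] p`, and the `x_i`-coefficient matrix of the tail chain is
  `Σ_{t : v_t = i} N_t` (the degree-one rule `ro_coeff_single`, re-proved here);
* `chain_sq_reads_eq` — hence, for a chain computing `E_02(P') = Matrix.transvection 0 2 P'`, the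
  second moment equals `[x_i²]P' · E_02`; in particular it vanishes when `P'` is multilinear.
-/

-- `Summit.ValiantsHypothesis.ValiantsHypothesis.…` is the tree's mandated single-conjunct layout.
set_option linter.dupNamespace false

namespace Summit.ValiantsHypothesis.ValiantsHypothesis.Theorems.WordPerSuperQuartic

open MvPolynomial

/-- Entrywise constant coefficient of a chain `Π_t (1 + x_{v_t} • N_t)`: `δ_ab`. -/
private theorem ro_constantCoeff_apply {σ : Type} (L : List (σ × Matrix (Fin 3) (Fin 3) ℂ))
    (a b : Fin 3) :
    constantCoeff ((L.map (fun e => (1 : Matrix (Fin 3) (Fin 3) (MvPolynomial σ ℂ)) +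
        (X e.1 : MvPolynomial σ ℂ) • e.2.map (C : ℂ → MvPolynomial σ ℂ))).prod a b) =
      (1 : Matrix (Fin 3) (Fin 3) ℂ) a b := by
  have h : (constantCoeff : MvPolynomial σ ℂ →+* ℂ).mapMatrix
      (L.map (fun e => (1 : Matrix (Fin 3) (Fin 3) (MvPolynomial σ ℂ)) +
        (X e.1 : MvPolynomial σ ℂ) • e.2.map (C : ℂ → MvPolynomial σ ℂ))).prod = 1 := by
    rw [map_list_prod, List.map_map, List.prod_eq_one]
    intro x hx
    obtain ⟨e, _, rfl⟩ := List.mem_map.1 hx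
    rw [Function.comp_apply, map_add, map_one, add_eq_left]
    ext a b
    simp
  have h' := congrFun (congrFun h a) b
  rwa [RingHom.mapMatrix_apply, Matrix.map_apply] at h'

/-- Degree-one rule: the `x_i`-coefficient of the `(a,b)` entry of a chain `Π_t (1 + x_{v_t} • N_t)`
is the `(a,b)` entry of `Σ_{t : v_t = i} N_t`. -/
private theorem ro_coeff_single {σ : Type} [DecidableEq σ]
    (L : List (σ × Matrix (Fin 3) (Fin 3) ℂ)) (i : σ) (a b : Fin 3) :
    coeff (Finsupp.single i 1) ((L.map (fun e => (1 : Matrix (Fin 3) (Fin 3) (MvPolynomial σ ℂ)) +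
        (X e.1 : MvPolynomial σ ℂ) • e.2.map (C : ℂ → MvPolynomial σ ℂ))).prod a b) =
      (L.map (fun e => if e.1 = i then e.2 else 0)).sum a b := by
  have hne : (0 : σ →₀ ℕ) ≠ Finsupp.single i 1 := (Finsupp.single_ne_zero.mpr one_ne_zero).symm
  induction L generalizing a b with
  | nil =>
    simp only [List.map_nil, List.prod_nil, List.sum_nil, Matrix.zero_apply, Matrix.one_apply]
    split_ifs <;> simp [coeff_one, hne]
  | cons e L ih =>
    simp only [List.map_cons, List.prod_cons, List.sum_cons]
    rw [Matrix.add_mul, Matrix.one_mul, Matrix.add_apply, coeff_add, ih, Matrix.add_apply,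
      add_comm]
    congr 1
    rw [Matrix.smul_mul, Matrix.smul_apply, smul_eq_mul, Matrix.mul_apply, coeff_X_mul']
    by_cases hvi : e.1 = i
    · subst hvi
      rw [if_pos (by simp), if_pos rfl, tsub_self, coeff_sum]
      simp only [Matrix.map_apply, coeff_C_mul, ← constantCoeff_eq, ro_constantCoeff_apply,
        Matrix.one_apply, mul_ite, mul_one, mul_zero, Finset.sum_ite_eq', Finset.mem_univ,
        if_true]
    · have hmem : e.1 ∉ (Finsupp.single i 1).support := by
        rw [Finsupp.mem_support_iff, Finsupp.single_apply, if_neg (Ne.symm hvi)]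
        exact fun h => h rfl
      rw [if_neg hmem, if_neg hvi, Matrix.zero_apply]

/-- Peeling off the first letter of the time-ordered second moment
`Σ_t [v_t = i] • N_t * (Σ_{t' > t} [v_{t'} = i] • N_{t'})`. -/
private theorem ro_moment_cons {σ : Type} [DecidableEq σ] (i : σ)
    (e : σ × Matrix (Fin 3) (Fin 3) ℂ) (L : List (σ × Matrix (Fin 3) (Fin 3) ℂ)) :
    (∑ t : Fin (e :: L).length, if ((e :: L).get t).1 = i then
        ((e :: L).get t).2 *
          (((e :: L).drop (t.1 + 1)).map (fun e => if e.1 = i then e.2 else 0)).sum else 0) =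
      (if e.1 = i then e.2 * (L.map (fun e => if e.1 = i then e.2 else 0)).sum else 0) +
        ∑ t : Fin L.length, if (L.get t).1 = i then
          (L.get t).2 * ((L.drop (t.1 + 1)).map (fun e => if e.1 = i then e.2 else 0)).sum
          else 0 := by
  exact (Fin.sum_univ_succ (n := L.length) _).trans rfl

/-- The `x_i²`-coefficient of the `(a,b)` entry of a chain `Π_t (1 + x_{v_t} • N_t)` is the `(a,b)`
entry of the time-ordered second moment `Σ_{t < t', v_t = v_{t'} = i} N_t N_{t'}`. -/
private theorem ro_coeff_sq {σ : Type} [DecidableEq σ]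
    (L : List (σ × Matrix (Fin 3) (Fin 3) ℂ)) (i : σ) (a b : Fin 3) :
    coeff (Finsupp.single i 2) ((L.map (fun e => (1 : Matrix (Fin 3) (Fin 3) (MvPolynomial σ ℂ)) +
        (X e.1 : MvPolynomial σ ℂ) • e.2.map (C : ℂ → MvPolynomial σ ℂ))).prod a b) =
      (∑ t : Fin L.length, if (L.get t).1 = i then
        (L.get t).2 * ((L.drop (t.1 + 1)).map (fun e => if e.1 = i then e.2 else 0)).sum
        else 0) a b := by
  have hne : (0 : σ →₀ ℕ) ≠ Finsupp.single i 2 := (Finsupp.single_ne_zero.mpr two_ne_zero).symm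
  induction L generalizing a b with
  | nil =>
    simp only [List.map_nil, List.prod_nil, List.length_nil, Finset.univ_eq_empty,
      Finset.sum_empty, Matrix.zero_apply, Matrix.one_apply]
    split_ifs <;> simp [coeff_one, hne]
  | cons e L ih =>
    rw [ro_moment_cons, List.map_cons, List.prod_cons, Matrix.add_mul, Matrix.one_mul,
      Matrix.add_apply, coeff_add, ih, Matrix.add_apply, add_comm]
    congr 1
    rw [Matrix.smul_mul, Matrix.smul_apply, smul_eq_mul, Matrix.mul_apply, coeff_X_mul']
    by_cases hvi : e.1 = i
    · subst hvi
      have hsub : Finsupp.single e.1 2 - Finsupp.single e.1 1 = Finsupp.single e.1 1 := by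
        rw [← Finsupp.single_tsub]
      rw [if_pos (by simp), if_pos rfl, hsub, coeff_sum, Matrix.mul_apply]
      simp only [Matrix.map_apply, coeff_C_mul, ro_coeff_single]
    · have hmem : e.1 ∉ (Finsupp.single i 2).support := by
        rw [Finsupp.mem_support_iff, Finsupp.single_apply, if_neg (Ne.symm hvi)]
        exact fun h => h rfl
      rw [if_neg hmem, if_neg hvi, Matrix.zero_apply]

/-- **The `x_i²` sum rule.**  If a chain `Π_t (1 + x_{v_t} • N_t)` computes `E_02(P')`, the
time-ordered second moment `Σ_{t < t', v_t = v_{t'} = i} N_t N_{t'}` of the matrices read at the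
variable `x_i` equals `[x_i²]P' · E_02` (registered helper of stub `stub_chainHardness`; it vanishes
for multilinear `P'`). -/
theorem chain_sq_reads_eq : ∀ {σ : Type} [DecidableEq σ] (L : List (σ × Matrix (Fin 3) (Fin 3) ℂ))
    (P' : MvPolynomial σ ℂ),
    (L.map (fun e => (1 : Matrix (Fin 3) (Fin 3) (MvPolynomial σ ℂ)) +
        (MvPolynomial.X e.1 : MvPolynomial σ ℂ) •
          e.2.map (MvPolynomial.C : ℂ → MvPolynomial σ ℂ))).prod =
      Matrix.transvection (0 : Fin 3) 2 P' →
    ∀ i : σ, (∑ t : Fin L.length, if (L.get t).1 = i then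
        (L.get t).2 * ((L.drop (t.1 + 1)).map (fun e => if e.1 = i then e.2 else 0)).sum else 0) =
      Matrix.single (0 : Fin 3) 2 (MvPolynomial.coeff (Finsupp.single i 2) P') := by
  intro σ _ L P' h i
  have hne : (0 : σ →₀ ℕ) ≠ Finsupp.single i 2 := (Finsupp.single_ne_zero.mpr two_ne_zero).symm
  ext a b
  rw [← ro_coeff_sq L i a b, h]
  simp only [Matrix.transvection, Matrix.add_apply, Matrix.one_apply, Matrix.single_apply,
    coeff_add]
  split_ifs <;> simp [coeff_one, hne]

end Summit.ValiantsHypothesis.ValiantsHypothesis.Theorems.WordPerSuperQuartic
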